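import Summits.QuantumFields.YangMills.Theorems.UnitScaleTiltProp7AliasSumBernstein
import HarnessLib

/-!
# Route `UnitScaleTilt`, crux K1 «MinimiserStabilityRegPr» (stmt-QuantumFields-19200), route-R E′ S3 ∕ line «HKGK-ANALYTIC» (C5)-FLAT, FILE 1 (B5 carrier) —
# BERNSTEIN FOR THE CURL-MINIMAL INTERPOLANT: if `Δ_n u = c·((Q_n)ᴴB)_κ` on the fine torus `Tor (fine n M)` with `u ⊥ 1` and `B` mean-free in direction `κ`,
# then `n²·Σ_{x,ν}|u(x+e_ν) − u(x)|² ≤ C_B·Σ_x|u(x)|²`, `C_B = dπ² + (π²∕4)^{d+1}(dπ²)²∕4` ABSOLUTE (✓`Prop7AliasSumBernstein.bernstein_QvOp_adjoint_pos` read on `u`)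

Cell `ym3-torus`, twin-width seat `ym-ust-19936-w8` (gen 5); row «(C5)-FLAT» of ★ym-ust-19200-w4 g7's HKGK-ANALYTIC chain (his target statement 2026-08-28 23:38:17Z:
`Theorems/UnitScaleTiltProp7FlatRRowConst.lean` in `Site (F.P K) 0` letters; THIS FILE is its carrier-side core, the `EK`-dictionary to the T³ family's letters is FILE 2).
THEOREMS ONLY (0 `def`, 0 `sorry`); `--supports stmt-QuantumFields-19200 --as helper`, count-neutral.  YM₃ on T³ is a ladder rung (R3), not the Clay problem; nothing here
claims S3, hKg-K, E′, the stub, the crux, d = 4 or the mass gap.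

WHY.  (C5) of LOCATE-B1-BERNSTEIN (★w4 g7, 87e0854625892084): `ℛ_flat ≤ C_B` — the flat leading order of the ℛ-ROW★ behind hKg-K — is the statement that the CURL-MINIMAL
INTERPOLANT `u = Δ⁻¹(Q_kᵀν)` of coarse co-closed mean-free data `ν` is BLOCK-SMOOTH: `‖∇u‖² ≤ C_B·ℓ⁻²·‖u‖²`.  ✓p676293 `bernstein_QvOp_adjoint_pos` proves it in the
form `re⟪g, Δ_n⁻¹g⟫ ≤ C_B·‖Δ_n⁻¹g‖²`, `g = ((Q_n)ᴴB)_κ`; this file reads that on `u` itself: `Δ_n = (∂^n)^*∂^n` (✓`B5Action121.LapS`, lattice factor `n`), so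
`re⟪u, Δ_nu⟫ = n²·Σ|u(x+e_ν) − u(x)|²`, and `u ⊥ 1` makes `u = Δ_n⁻¹(Δ_nu)` (✓`B5LaplaceInverse.LapSinv_LapS_of_orth`); the scale `c` is free (both sides are quadratic).

WHAT IS PROVED (ns `…Theorems.Prop7FlatRRowConstTorus`; `Tor N` any B5 torus, then `N := fine n M`):
* §1 `star_dotProduct_LapS_mulVec` (`u^*Δ_cu = Σ_ν‖∂^c_νu‖²`), `sum_norm_sdiff_sq` (`Σ_x‖(∂^c_νu)(x)‖² = |c|²Σ_x‖u(x+e_ν) − u(x)‖²`), `re_star_dotProduct_comm`.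
* §2 ★★ `bernstein_interpolant (hn : 1 ≤ n) (B) (κ) (hB : Σ_y B(y,κ) = 0) (c) (u) (hu : Σ u = 0) (hLap : Δ_n u = c • ((Q_n)ᴴB)_κ)` :
  `(n:ℝ)²·Σ_ν Σ_x ‖u(x+e_ν) − u(x)‖² ≤ C_B·Σ_x ‖u x‖²`.
HONEST SCOPE.  Linear algebra over two landed files; no new estimate; the T³-letter reading (FILE 2) and everything curved are not here.

References: T. Bałaban, CMP 95 (1984) 17–40 [Balaban1984PropagatorsI] ((1.4) p.18, (1.18) p.20, (1.21) p.21, Sect. C p.22); CMP 99 (1985) 389–434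
[Balaban1985BackgroundPropagators] (Thm 3.11 p.416).
-/

set_option autoImplicit false

noncomputable section

open scoped BigOperators Matrix ComplexConjugate

namespace Summit.QuantumFields.YangMills.Theorems.Prop7FlatRRowConstTorus

open Literature.MathematicalPhysics.QuantumFieldTheory.Balaban1983to89
open Finset B5Prop11Plancherel B5Action121 B5Block118 B5LaplaceInverse
open Summit.QuantumFields.YangMills.Theorems.Prop7AliasSumBernstein (bernstein_QvOp_adjoint_pos)

/-! ## §1 The Dirichlet form of `Δ_c` -/

section Dirichlet

variable {d : ℕ} (N : Fin d → ℕ) [hN : ∀ μ, NeZero (N μ)]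

/-- **`u^*Δ_cu = Σ_ν ‖∂^c_νu‖²`** — `Δ_c = Σ_ν (∂^c_ν)^*∂^c_ν` (✓`B5Action121.LapS`). [cite: Balaban1984PropagatorsI, (1.21) p.21] -/
theorem star_dotProduct_LapS_mulVec (c : ℂ) (u : Tor N → ℂ) :
    star u ⬝ᵥ (LapS N c *ᵥ u) = ((∑ ν : Fin d, ∑ x, ‖(sdiff N c ν *ᵥ u) x‖ ^ 2 : ℝ) : ℂ) := by
  -- `v^*v = Σ_x ‖v x‖²` (the tree's `N07PointFeasibilityOneLevel.star_dotProduct_self`, inlined to keep the imports light)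
  have hself : ∀ v : Tor N → ℂ, star v ⬝ᵥ v = ((∑ x, ‖v x‖ ^ 2 : ℝ) : ℂ) := fun v => by
    rw [dotProduct, Complex.ofReal_sum]
    refine Finset.sum_congr rfl fun x _ => ?_
    rw [Pi.star_apply, Complex.star_def, Complex.sq_norm, Complex.normSq_eq_conj_mul_self]
  rw [LapS, Matrix.sum_mulVec, dotProduct_sum, Complex.ofReal_sum]
  refine Finset.sum_congr rfl fun ν _ => ?_
  rw [form_gram_rect, hself]

/-- `Σ_x ‖(∂^c_νu)(x)‖² = ‖c‖²·Σ_x ‖u(x + e_ν) − u(x)‖²`. [cite: Balaban1984PropagatorsI, (1.4) p.18] -/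
theorem sum_norm_sdiff_sq (c : ℂ) (ν : Fin d) (u : Tor N → ℂ) :
    ∑ x, ‖(sdiff N c ν *ᵥ u) x‖ ^ 2 = ‖c‖ ^ 2 * ∑ x, ‖u (x + unitVec N ν) - u x‖ ^ 2 := by
  rw [Finset.mul_sum]
  refine Finset.sum_congr rfl fun x _ => ?_
  rw [sdiff_mulVec, norm_mul, mul_pow]

/-- `re(a^*b) = re(b^*a)`. [folklore] -/
theorem re_star_dotProduct_comm {ι : Type*} [Fintype ι] (a b : ι → ℂ) : (star a ⬝ᵥ b).re = (star b ⬝ᵥ a).re := by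
  simp only [dotProduct, Complex.re_sum, Pi.star_apply, Complex.star_def, Complex.mul_re, Complex.conj_re, Complex.conj_im]
  refine Finset.sum_congr rfl fun x _ => ?_
  ring

end Dirichlet

/-! ## §2 Bernstein for the curl-minimal interpolant -/

section Bernstein

variable {d : ℕ} (n : ℕ) [NeZero n] (M : Fin d → ℕ) [hM : ∀ μ, NeZero (M μ)]

/-- ★★ **BERNSTEIN FOR THE CURL-MINIMAL INTERPOLANT** (`C_B = dπ² + (π²∕4)^{d+1}(dπ²)²∕4`, absolute): on the fine torus `Tor (fine n M)` (`n ≥ 1`), if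
`Δ_n u = c·((Q_n)ᴴB)_κ` (`Q_n` = Bałaban's straight vector average (1.18) `B5Block118.QvOp n M`, `κ`-component; any scale `c : ℂ`), `Σ_x u(x) = 0`, and the coarse datum
`B` is MEAN-FREE in direction `κ` (`Σ_y B(y,κ) = 0`), then `n²·Σ_ν Σ_x |u(x+e_ν) − u(x)|² ≤ C_B·Σ_x |u(x)|²` — the interpolant is BLOCK-SMOOTH (its spectrum sits at
`|p| ≲ 1∕n` up to alias tails), uniformly in `n`, `M`, `c`.  (✓p676293 `bernstein_QvOp_adjoint_pos` on `g = ((Q_n)ᴴB)_κ`, read on `u = c·Δ_n⁻¹g`.)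
[cite: Balaban1984PropagatorsI, (1.18) p.20, (1.21) p.21, Sect. C p.22; Balaban1985BackgroundPropagators, Thm 3.11 p.416] -/
theorem bernstein_interpolant (hn : 1 ≤ n) (B : Tor M × Fin d → ℂ) (κ : Fin d) (hB : ∑ y, B (y, κ) = 0)
    (c : ℂ) (u : Tor (fine n M) → ℂ) (hu : ∑ x, u x = 0)
    (hLap : LapS (fine n M) (n : ℂ) *ᵥ u = c • comp (fine n M) ((QvOp n M)ᴴ *ᵥ B) κ) :
    (n : ℝ) ^ 2 * ∑ ν : Fin d, ∑ x, ‖u (x + unitVec (fine n M) ν) - u x‖ ^ 2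
      ≤ (d * Real.pi ^ 2 + (Real.pi ^ 2 / 4) ^ (d + 1) * (d * Real.pi ^ 2) ^ 2 / 4) * ∑ x, ‖u x‖ ^ 2 := by
  set g : Tor (fine n M) → ℂ := comp (fine n M) ((QvOp n M)ᴴ *ᵥ B) κ with hg
  set v : Tor (fine n M) → ℂ := LapSinv (fine n M) (n : ℂ) *ᵥ g with hv
  set CB : ℝ := d * Real.pi ^ 2 + (Real.pi ^ 2 / 4) ^ (d + 1) * (d * Real.pi ^ 2) ^ 2 / 4 with hCB
  have hn0 : ((n : ℕ) : ℂ) ≠ 0 := by exact_mod_cast (Nat.one_le_iff_ne_zero.mp hn)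
  -- `u = c • Δ_n⁻¹ g`
  have huv : u = c • v := by
    have h := LapSinv_LapS_of_orth (fine n M) hn0 u hu
    rw [hLap, Matrix.mulVec_smul] at h
    rw [hv]; exact h.symm
  -- Bernstein in the `g`-form
  have hbern : (star g ⬝ᵥ v).re ≤ CB * ∑ x, ‖v x‖ ^ 2 := by
    have h := bernstein_QvOp_adjoint_pos n M hn B κ hB
    rw [← hg] at h
    exact h
  -- the left side: `u^*Δ_nu = n²·Σ|∇u|²`
  have hL : ((((n : ℝ) ^ 2 * ∑ ν : Fin d, ∑ x, ‖u (x + unitVec (fine n M) ν) - u x‖ ^ 2 : ℝ)) : ℂ)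
      = star u ⬝ᵥ (LapS (fine n M) (n : ℂ) *ᵥ u) := by
    rw [star_dotProduct_LapS_mulVec]
    congr 1
    rw [Finset.mul_sum]
    refine Finset.sum_congr rfl fun ν _ => ?_
    rw [sum_norm_sdiff_sq]
    norm_cast
  -- the same left side as `|c|²·(v^* g)`
  have hL' : star u ⬝ᵥ (LapS (fine n M) (n : ℂ) *ᵥ u) = (starRingEnd ℂ c * c) * (star v ⬝ᵥ g) := by
    rw [hLap, huv, star_smul, smul_dotProduct, dotProduct_smul, smul_eq_mul, smul_eq_mul, Complex.star_def]
    ring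
  have hcc : (starRingEnd ℂ c * c) = ((‖c‖ ^ 2 : ℝ) : ℂ) := by
    rw [Complex.sq_norm, Complex.normSq_eq_conj_mul_self]
  have hre : (n : ℝ) ^ 2 * ∑ ν : Fin d, ∑ x, ‖u (x + unitVec (fine n M) ν) - u x‖ ^ 2 = ‖c‖ ^ 2 * (star g ⬝ᵥ v).re := by
    have h := congrArg Complex.re (hL.trans hL')
    rw [Complex.ofReal_re, hcc, Complex.re_ofReal_mul, re_star_dotProduct_comm v g] at h
    exact h
  -- the right side: `Σ‖u‖² = |c|²·Σ‖v‖²`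
  have hR : ∑ x, ‖u x‖ ^ 2 = ‖c‖ ^ 2 * ∑ x, ‖v x‖ ^ 2 := by
    rw [huv, Finset.mul_sum]
    refine Finset.sum_congr rfl fun x _ => ?_
    rw [Pi.smul_apply, smul_eq_mul, norm_mul, mul_pow]
  rw [hre, hR]
  have hc0 : 0 ≤ ‖c‖ ^ 2 := sq_nonneg _
  calc ‖c‖ ^ 2 * (star g ⬝ᵥ v).re ≤ ‖c‖ ^ 2 * (CB * ∑ x, ‖v x‖ ^ 2) := mul_le_mul_of_nonneg_left hbern hc0
    _ = CB * (‖c‖ ^ 2 * ∑ x, ‖v x‖ ^ 2) := by ring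

end Bernstein

end Summit.QuantumFields.YangMills.Theorems.Prop7FlatRRowConstTorus

end
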